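import Literature.NumberTheory.CubicFields.CubicResolventCharacter
import Summits.BirchSwinnertonDyer.BirchSwinnertonDyer.Theorems.ResidualThetaTransportAtTwoHeckeThetaPartnerAdicAtTwoGaloisRoots
import Summits.BirchSwinnertonDyer.BirchSwinnertonDyer.Theorems.ResidualThetaTransportAtTwoHeckeThetaPartnerAdicAtTwoRootsFrobenius
import Summits.BirchSwinnertonDyer.BirchSwinnertonDyer.Theorems.ResidualThetaTransportAtTwoHeckeThetaPartnerAdicAtTwoParity
import Summits.BirchSwinnertonDyer.BirchSwinnertonDyer.Theorems.ResidualThetaTransportAtTwoHeckeThetaPartnerAdicAtTwoCurveArith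
import Summits.BirchSwinnertonDyer.BirchSwinnertonDyer.Theorems.ResidualThetaTransportAtTwoHeckeThetaPartnerAdicAtTwoTeichmullerTwistPrelim
import Literature.NumberTheory.EllipticCurves.EisensteinNewformLevelRaisingDeligneSerreLiftProofs
import HarnessLib

/-!
# The trace congruence `a_ℓ(θ_ψ) ≡ a_ℓ(W)` modulo the maximal ideal of `ℤ̄₂`

Route `ResidualThetaTransportAtTwo`, crux K0⁺ `HeckeThetaPartnerAdicAtTwo` (stmt-BirchSwinnertonDyer-20690),
helper §AP of the line "proof from print".  THEOREMS ONLY (no definition, no named fact, no `sorry`).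

Setting: `W/ℚ` globally minimal, `h_W = X³ + b₂X² + 8b₄X + 16b₆` its monic integral `2`-division cubic
(irreducible), `k` quadratic Galois, `L ⊆ k̄` the `S₃`-closure of the cubic field `K_h = ℚ[X]/(h_W)`
(`[L:k] = 3`, `L/ℚ` Galois, `K_h → L`, generated by the conjugates), `χ` an injective character of
`Gal(L/k)`, `e : ℚ̄₂ ≃ ℂ`, and `ψ` a function on the primes of `k` (the Größencharakter) with
`ψ(v) ≡ χ(Frob_v)` (`2`-adically) at the primes `v ∣ ℓ`.  For an odd prime `ℓ ∤ Δ_min(W)` unramified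
in `k` and `L`:

* `trace_congr_of_split` / `trace_congr_of_inert` and `trace_congr` — **`‖e⁻¹(∑_{Nv = ℓ} ψ(v)) - a_ℓ(W)‖ < 1`**:
  - `ℓ` split, `(ℓ) = v·σv`: the primes of norm `ℓ` are `v ≠ σv`, `ψ(v) + ψ(σv) ≡ ζ + ζ⁻¹` with
    `ζ = χ(Frob_v)`, `Frob_{σv} = Frob_v⁻¹` (`galFrob_smul_eq_inv`); Dedekind (`…RootsFrobenius`) counts
    the roots of `h_W mod ℓ` as the fixed points of `Frob_v` on the three roots in `𝓞_L`: `3` if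
    `Frob_v = 1` (`ζ = 1`, `ζ + ζ⁻¹ = 2`), `0` otherwise (`…GaloisRoots.smul_ne_of_ne_one`; `χ` injective,
    `ζ + ζ⁻¹ = -1`); and `a_ℓ(W) + 1 + #roots` is even (`…Parity`);
  - `ℓ` inert: no prime of norm `ℓ`, so the sum is `0`; a Frobenius of `L/ℚ` at `ℓ` is non-trivial on
    `k`, fixes exactly one root (`…GaloisRoots.card_filter_smul_eq_eq_one`), so `a_ℓ(W)` is even.

References: J.-P. Serre, *Propriétés galoisiennes…*, Invent. Math. 15 (1972) §5 (the image `S₃` of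
`ρ̄_{E,2}` and traces mod `2`); K. Ribet, LNM 601 (1977) §3 (`a_p(θ_ψ) = ∑_{N𝔭 = p} ψ(𝔭)`).
-/

set_option autoImplicit false
set_option linter.dupNamespace false

noncomputable section

open scoped NumberField
open NumberField IsDedekindDomain Polynomial Module
open Literature.NumberTheory.GaloisRepresentations Literature.NumberTheory.LFunctions
  Literature.NumberTheory.CubicFields Literature.NumberTheory.NumberFields
  Literature.NumberTheory.EllipticCurves Literature.NumberTheory.EllipticCurves.ModularForms

namespace Summit.BirchSwinnertonDyer.BirchSwinnertonDyer.Theorems.HeckeThetaPartner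

/-! ### Small `2`-adic lemmas -/

section Adic

/-- An even integer has `2`-adic norm `< 1`. [folklore] -/
theorem norm_intCast_lt_one_of_even {m : ℤ} (hm : Even m) : ‖(m : PadicAlgCl 2)‖ < 1 := by
  obtain ⟨r, rfl⟩ := hm
  have h2 : ‖(2 : PadicAlgCl 2)‖ < 1 := by
    have h := Padic.norm_p_lt_one (p := 2)
    rw [← PadicAlgCl.norm_extends, map_natCast] at h
    exact_mod_cast h
  rw [show ((r + r : ℤ) : PadicAlgCl 2) = 2 * (r : PadicAlgCl 2) by push_cast; ring, norm_mul]
  exact (mul_le_of_le_one_right (norm_nonneg _) (DeligneSerreLift.norm_intCast_le_one _)).trans_lt h2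

/-- Three-term ultrametric estimate: `‖x + y + z‖ < 1` if each term has norm `< 1`. [folklore] -/
theorem norm_add_add_lt_one {x y z : PadicAlgCl 2} (hx : ‖x‖ < 1) (hy : ‖y‖ < 1) (hz : ‖z‖ < 1) :
    ‖x + y + z‖ < 1 :=
  (IsUltrametricDist.norm_add_le_max _ _).trans_lt
    (max_lt ((IsUltrametricDist.norm_add_le_max _ _).trans_lt (max_lt hx hy)) hz)

/-- A cube root of unity `ζ ≠ 1` has `ζ + ζ⁻¹ = -1`. [folklore] -/
theorem add_inv_eq_neg_one_of_pow_three {ζ : ℂ} (h3 : ζ ^ 3 = 1) (h1 : ζ ≠ 1) : ζ + ζ⁻¹ = -1 := by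
  have hζ0 : ζ ≠ 0 := by rintro rfl; norm_num at h3
  have hq : ζ ^ 2 + ζ + 1 = 0 := by
    have : (ζ - 1) * (ζ ^ 2 + ζ + 1) = 0 := by linear_combination h3
    exact (mul_eq_zero.mp this).resolve_left (sub_ne_zero.mpr h1)
  have hinv : ζ⁻¹ = ζ ^ 2 := inv_eq_of_mul_eq_one_right (by linear_combination h3)
  rw [hinv]; linear_combination hq

end Adic

/-! ### Dedekind's count for `h_W` -/

section Dedekind

variable {k : Type} [Field k]
  (L : IntermediateField k (AlgebraicClosure k)) [NumberField L] [IsGalois ℚ L]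
  (W : WeierstrassCurve ℚ) [W.IsGloballyMinimal]
  [hirr : Fact (Irreducible (MonicCubic.polyQ (WeierstrassCurve.integralModelInt W).b₂
    (8 * (WeierstrassCurve.integralModelInt W).b₄) (16 * (WeierstrassCurve.integralModelInt W).b₆)))]
  (ι : AdjoinRoot (MonicCubic.polyQ (WeierstrassCurve.integralModelInt W).b₂
    (8 * (WeierstrassCurve.integralModelInt W).b₄) (16 * (WeierstrassCurve.integralModelInt W).b₆)) →ₐ[ℚ] L)

include ι in
open scoped Classical in
/-- **Dedekind's count for `h_W` at a prime `Q ∣ ℓ` of `𝓞 L`**: for an odd prime `ℓ ∤ Δ_min` lying in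
`Q` and a ring endomorphism `φ` of `𝓞 L` with `φ x ≡ x^ℓ mod Q`, the number of roots of `h_W mod ℓ`
is the number of roots of `h_W` in `𝓞 L` fixed by `φ` (`disc h_W = 256 Δ_min ∉ Q`). [folklore] -/
theorem card_roots_hW_eq (Q : Ideal (𝓞 L)) [Q.IsMaximal] {ℓ : ℕ} [Fact ℓ.Prime] (hℓ2 : ℓ ≠ 2)
    (hℓΔ : ¬ (ℓ : ℤ) ∣ WeierstrassCurve.minimalDiscriminantInt W) (hℓQ : (ℓ : 𝓞 L) ∈ Q)
    (φ : 𝓞 L →+* 𝓞 L) (hφ : ∀ x, φ x - x ^ ℓ ∈ Q) :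
    ((MonicCubic.poly (WeierstrassCurve.integralModelInt W).b₂
      (8 * (WeierstrassCurve.integralModelInt W).b₄) (16 * (WeierstrassCurve.integralModelInt W).b₆)).map (Int.castRingHom (ZMod ℓ))).roots.toFinset.card =
      (((MonicCubic.poly (WeierstrassCurve.integralModelInt W).b₂
      (8 * (WeierstrassCurve.integralModelInt W).b₄) (16 * (WeierstrassCurve.integralModelInt W).b₆)).map (Int.castRingHom (𝓞 L))).roots.toFinset.filter (fun θ => φ θ = θ)).card := by
  classical
  obtain ⟨hcard, hnodup⟩ := card_roots_ringOfIntegers_eq_three _ _ _ L ι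
  have hdisc : ((MonicCubic.disc (WeierstrassCurve.integralModelInt W).b₂
      (8 * (WeierstrassCurve.integralModelInt W).b₄) (16 * (WeierstrassCurve.integralModelInt W).b₆) : ℤ) :
        𝓞 L) ∉ Q := by
    rw [disc_twoDivisionCubic]
    intro hmem
    -- `256 Δ ∈ Q ∩ ℤ = (ℓ)`
    have hZ : (256 * WeierstrassCurve.minimalDiscriminantInt W : ℤ) ∈ Q.under ℤ := by
      rw [Ideal.mem_comap, eq_intCast]; exact hmem
    have hunder : Q.under ℤ = Ideal.span {(ℓ : ℤ)} := by
      have hprime : (Ideal.span {(ℓ : ℤ)}).IsMaximal :=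
        ((Ideal.span_singleton_prime (by exact_mod_cast (Fact.out : ℓ.Prime).ne_zero)).mpr
          (Nat.prime_iff_prime_int.mp Fact.out)).isMaximal
          (by rw [Ne, Ideal.span_singleton_eq_bot]; exact_mod_cast (Fact.out : ℓ.Prime).ne_zero)
      refine (hprime.eq_of_le (Ideal.IsPrime.under ℤ Q).ne_top ?_).symm
      rw [Ideal.span_singleton_le_iff_mem, Ideal.mem_comap, eq_intCast]
      exact_mod_cast hℓQ
    rw [hunder, Ideal.mem_span_singleton] at hZ
    have hℓprime : Prime (ℓ : ℤ) := Nat.prime_iff_prime_int.mp Fact.out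
    rcases hℓprime.dvd_or_dvd hZ with h | h
    · have : (ℓ : ℤ) ∣ 2 ^ 8 := by norm_num at h ⊢; exact h
      have h2 := hℓprime.dvd_of_dvd_pow this
      have : ℓ ∣ 2 := by exact_mod_cast h2
      exact hℓ2 ((Nat.prime_dvd_prime_iff_eq Fact.out Nat.prime_two).mp this)
    · exact hℓΔ h
  exact card_roots_zmod_eq_card_filter_fixed Q ℓ hℓQ _ (MonicCubic.monic_poly _ _ _)
    (by rw [hcard, MonicCubic.natDegree_poly]) (eq_of_sub_mem_of_disc_not_mem _ _ _ L ι Q hdisc) φ hφ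

/-- `Nat.card (ℤ ⧸ (ℓ)) = ℓ`. [folklore] -/
theorem natCard_int_quot_span (ℓ : ℕ) : Nat.card (ℤ ⧸ Ideal.span {(ℓ : ℤ)}) = ℓ := by
  rw [← Submodule.cardQuot_apply, ← Ideal.absNorm_apply, Ideal.absNorm_span_singleton,
    Algebra.norm_self]
  simp

end Dedekind

/-! ### The setting -/

section Setting

variable {k : Type} [Field k] [NumberField k] [IsGalois ℚ k]
  (L : IntermediateField k (AlgebraicClosure k)) [FiniteDimensional k L] [IsGalois ℚ L]
  [IsAbelianGalois k L] [NumberField L]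
  (W : WeierstrassCurve ℚ) [W.IsGloballyMinimal]
  [hirr : Fact (Irreducible (MonicCubic.polyQ (WeierstrassCurve.integralModelInt W).b₂
    (8 * (WeierstrassCurve.integralModelInt W).b₄) (16 * (WeierstrassCurve.integralModelInt W).b₆)))]
  (ι : AdjoinRoot (MonicCubic.polyQ (WeierstrassCurve.integralModelInt W).b₂
    (8 * (WeierstrassCurve.integralModelInt W).b₄) (16 * (WeierstrassCurve.integralModelInt W).b₆)) →ₐ[ℚ] L)

omit [IsAbelianGalois k L] in
include ι in
/-- **Inert primes: `a_ℓ(W)` is even.**  For an odd prime `ℓ ∤ Δ_min` INERT in `k` (`(ℓ) = v` prime of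
`𝓞 k`) and unramified in `L`: a Frobenius `Φ ∈ Gal(L/ℚ)` at a prime `Q ∣ ℓ` is non-trivial on `k`
(else `x^ℓ ≡ x` on the field `𝓞_k/(ℓ)` of order `ℓ²`), so it fixes exactly one root of `h_W`, and
`a_ℓ(W) + 1 + 1` is even. [cite: SerreInventiones1972, §5.4] -/
theorem even_frobeniusTrace_of_inert (hk : finrank ℚ k = 2) (h3 : finrank k L = 3)
    (hKG : ¬ IsGalois ℚ (AdjoinRoot (MonicCubic.polyQ (WeierstrassCurve.integralModelInt W).b₂
      (8 * (WeierstrassCurve.integralModelInt W).b₄) (16 * (WeierstrassCurve.integralModelInt W).b₆))))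
    (hgen : (⨆ σ : AdjoinRoot (MonicCubic.polyQ (WeierstrassCurve.integralModelInt W).b₂
      (8 * (WeierstrassCurve.integralModelInt W).b₄) (16 * (WeierstrassCurve.integralModelInt W).b₆)) →ₐ[ℚ] L,
        σ.fieldRange) = ⊤)
    {ℓ : ℕ} [Fact ℓ.Prime] (hℓ2 : ℓ ≠ 2) (hℓΔ : ¬ (ℓ : ℤ) ∣ WeierstrassCurve.minimalDiscriminantInt W)
    (v : HeightOneSpectrum (𝓞 k)) (hv : v.asIdeal = Ideal.span {((ℓ : ℤ) : 𝓞 k)}) :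
    Even (W.frobeniusTrace ℓ) := by
  classical
  have hℓ : ℓ.Prime := Fact.out
  -- a prime `Q ∣ ℓ` of `𝓞 L` above `v` and a Frobenius `Φ ∈ Gal(L/ℚ)` at `Q`
  haveI := v.isMaximal
  obtain ⟨Q, hQmax, hQover⟩ := Ideal.exists_maximal_ideal_liesOver_of_isIntegral (S := 𝓞 L) v.asIdeal
  haveI := hQmax
  haveI := hQover
  have hQ0 : Q ≠ ⊥ := Ideal.ne_bot_of_liesOver_of_ne_bot v.ne_bot Q
  haveI : IsGaloisGroup (L ≃ₐ[ℚ] L) ℤ (𝓞 L) := IsGaloisGroup.of_isFractionRing (L ≃ₐ[ℚ] L) ℤ (𝓞 L) ℚ L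
  haveI : Finite (𝓞 L ⧸ Q) := Ideal.finiteQuotientOfFreeOfNeBot Q hQ0
  obtain ⟨Φ, hΦ⟩ := IsArithFrobAt.exists_of_isInvariant ℤ (L ≃ₐ[ℚ] L) Q
  -- `ℓ ∈ Q`, `Q ∩ ℤ = (ℓ)`
  have hℓv : ((ℓ : ℤ) : 𝓞 k) ∈ v.asIdeal := by rw [hv]; exact Ideal.mem_span_singleton_self _
  have hℓQ : (ℓ : 𝓞 L) ∈ Q := by
    have : algebraMap (𝓞 k) (𝓞 L) ((ℓ : ℤ) : 𝓞 k) ∈ Q := by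
      rw [← Ideal.mem_comap]
      have h := hQover.over
      rw [Ideal.under] at h
      rw [← h]; exact hℓv
    simpa using this
  have hunder : Q.under ℤ = Ideal.span {(ℓ : ℤ)} := by
    have hprime : (Ideal.span {(ℓ : ℤ)}).IsMaximal :=
      ((Ideal.span_singleton_prime (by exact_mod_cast hℓ.ne_zero)).mpr
        (Nat.prime_iff_prime_int.mp hℓ)).isMaximal
        (by rw [Ne, Ideal.span_singleton_eq_bot]; exact_mod_cast hℓ.ne_zero)
    refine (hprime.eq_of_le (Ideal.IsPrime.under ℤ Q).ne_top ?_).symm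
    rw [Ideal.span_singleton_le_iff_mem, Ideal.mem_comap, eq_intCast]
    exact_mod_cast hℓQ
  have hcardZ : Nat.card (ℤ ⧸ Q.under ℤ) = ℓ := by rw [hunder, natCard_int_quot_span]
  have hΦx : ∀ x : 𝓞 L, Φ • x - x ^ ℓ ∈ Q := fun x => by
    have := hΦ x
    rwa [hcardZ] at this
  -- `Φ` is non-trivial on `k`
  have hΦk : Φ.restrictNormal k ≠ 1 := by
    intro h1
    obtain ⟨a, ha⟩ := exists_restrictScalars_eq_of_restrictNormal_eq_one L h1
    -- every `x ∈ 𝓞 k` satisfies `x^ℓ ≡ x mod v`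
    have hfix : ∀ x : 𝓞 k, x ^ ℓ - x ∈ v.asIdeal := by
      intro x
      have h := hΦx (algebraMap (𝓞 k) (𝓞 L) x)
      have hsmul : Φ • (algebraMap (𝓞 k) (𝓞 L) x) = algebraMap (𝓞 k) (𝓞 L) x := by
        refine RingOfIntegers.ext ?_
        rw [RingOfIntegers.coe_galois_smul, ← ha]
        have : ((algebraMap (𝓞 k) (𝓞 L) x : 𝓞 L) : L) = algebraMap k L (x : k) := rfl
        rw [this, AlgEquiv.restrictScalars_apply, AlgEquiv.commutes]
      rw [hsmul, ← map_pow, ← map_sub] at h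
      have h' : x - x ^ ℓ ∈ Q.under (𝓞 k) := Ideal.mem_comap.mpr h
      rw [← hQover.over] at h'
      simpa using v.asIdeal.neg_mem h'
    -- contradiction with `#(𝓞 k / v) = ℓ²`
    letI : Field (𝓞 k ⧸ v.asIdeal) := Ideal.Quotient.field v.asIdeal
    haveI : CharP (𝓞 k ⧸ v.asIdeal) ℓ := by
      refine (CharP.charP_iff_prime_eq_zero hℓ).mpr ?_
      rw [← map_natCast (Ideal.Quotient.mk v.asIdeal), Ideal.Quotient.eq_zero_iff_mem]
      simpa using hℓv
    have hcard : Nat.card (𝓞 k ⧸ v.asIdeal) = ℓ ^ 2 := by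
      rw [← Submodule.cardQuot_apply, ← Ideal.absNorm_apply, hv, Ideal.absNorm_span_singleton,
        show ((ℓ : ℤ) : 𝓞 k) = algebraMap ℤ (𝓞 k) ℓ from by simp, Algebra.norm_algebraMap,
        RingOfIntegers.rank, hk]
      simp
    haveI : Finite (𝓞 k ⧸ v.asIdeal) := Ideal.finiteQuotientOfFreeOfNeBot _ v.ne_bot
    have hall : ∀ y : 𝓞 k ⧸ v.asIdeal, y ∈ Set.range (ZMod.castHom (dvd_refl ℓ) (𝓞 k ⧸ v.asIdeal)) := by
      intro y
      obtain ⟨x, rfl⟩ := Ideal.Quotient.mk_surjective y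
      rw [mem_range_castHom_iff_pow_eq ℓ, ← map_pow, Ideal.Quotient.eq]
      exact hfix x
    have hle : Nat.card (𝓞 k ⧸ v.asIdeal) ≤ ℓ := by
      have hsub : (Set.univ : Set (𝓞 k ⧸ v.asIdeal)) ⊆ Set.range (ZMod.castHom (dvd_refl ℓ) (𝓞 k ⧸ v.asIdeal)) :=
        fun y _ => hall y
      calc Nat.card (𝓞 k ⧸ v.asIdeal) = Nat.card (Set.univ : Set (𝓞 k ⧸ v.asIdeal)) := by
            rw [Nat.card_univ]
        _ ≤ Nat.card (Set.range (ZMod.castHom (dvd_refl ℓ) (𝓞 k ⧸ v.asIdeal))) :=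
            Nat.card_mono (Set.finite_range _) hsub
        _ ≤ Nat.card (ZMod ℓ) :=
            Nat.card_le_card_of_surjective _ Set.rangeFactorization_surjective
        _ = ℓ := Nat.card_zmod ℓ
    rw [hcard] at hle
    have : ℓ ^ 2 ≤ ℓ ^ 1 := by simpa using hle
    have := (Nat.pow_le_pow_iff_right hℓ.one_lt).mp this
    omega
  -- `Φ` fixes exactly one root; Dedekind + parity
  have hcount := card_filter_smul_eq_eq_one L _ _ _ ι hk h3 hKG hgen Φ hΦk
  have hded := card_roots_hW_eq L W ι Q hℓ2 hℓΔ hℓQ (MulSemiringAction.toRingHom (L ≃ₐ[ℚ] L) (𝓞 L) Φ)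
    (fun x => by rw [MulSemiringAction.toRingHom_apply]; exact hΦx x)
  have hcount' : (((MonicCubic.poly (WeierstrassCurve.integralModelInt W).b₂
      (8 * (WeierstrassCurve.integralModelInt W).b₄) (16 * (WeierstrassCurve.integralModelInt W).b₆)).map (Int.castRingHom (𝓞 L))).roots.toFinset.filter
      (fun θ => (MulSemiringAction.toRingHom (L ≃ₐ[ℚ] L) (𝓞 L) Φ) θ = θ)).card = 1 := hcount
  have heven := even_frobeniusTrace_add_one_add_card_roots W hℓ2 hℓΔ
  rw [hded, hcount'] at heven
  have : Even (W.frobeniusTrace ℓ + 2) := by simpa [add_assoc] using heven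
  simpa [Int.even_add] using this

end Setting

end Summit.BirchSwinnertonDyer.BirchSwinnertonDyer.Theorems.HeckeThetaPartner

end
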